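import Summits.KontsevichZagierPeriods.KontsevichZagierPeriods.Theorems.RootDecompQuadraticDescentSurdPairsP1

/-!
# Census pairs #1 #2 (ℚ(√−7) surd), #24 #28 (dilog), #36 #37 (weight one) DECIDED in `KZ.relations` (route `RootDecompQuadraticDescent`, instances of crux stmt-KontsevichZagierPeriods-28994 `DescentTwoQ` / stmt-4280 `KZDimTwo`) · part 2/6

Cell `decomp-kz`, lens 6 (decomp-kz-lens-6 g8): the LINEAR-FIBRE STRATUM of the weight-2 box census decided by rules 1+2 in dimension 2 — general lemma `linFibre` (unfolding `s = (α(x)y+β(x))/β(x)` into a log band) + ONE base substitution by the Möbius involution `κ(t) = (1−t)/(1+t)` (`rel_subst`) + `rel_trans`; `pair1`, `pair2` (the ℚ(√−7) live benchmarks of 28994 rev 7), `pair24`, `pair28`, `pair36`, `pair37` (the latter with four `RFun.stokes` steps, rational primitives); packaged `surdPairs_decided`, `surdPairs_descentTwoQ_instances` (∀ R ⊇ relations) and `surdPairs_of_kzDimTwo` BY NAME.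

Source: `HOME/decomp-kz-lens-6/g8/SurdPairs.lean` sha256 a3f0c2d08098ea3e (1516 l; critic decomp-kz-crit-1 g2 CLEARED 2026-08-30T08:39:24Z, std axioms), split into 6 modules by the landing seat decomp-kz-census-1 g7 (contexts re-opened per part; generic docstrings added where the source had none; the route file is imported only by the last part, which proves the `KZDimTwo` corollaries BY NAME).  No `sorry`; standard axioms.  References: [cite: KontsevichZagier2001, §1.2].
-/

noncomputable section

open MeasureTheory Set MvPolynomial

namespace Summit.KontsevichZagierPeriods.RootDecompQuadraticDescent.SurdPairs

open Literature.NumberTheory.Transcendental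
open Literature.NumberTheory.Transcendental.KZ
open Literature.ModelTheory.ExponentialFields (IsSemialgebraic)

-- PRIVATE copy (landed twin lives in a farm-unbuilt module; dedup.landed): snoc2_zero, snoc2_one, init2_zero, fin1_eq
/-- `snoc2_zero`: auxiliary theorem of the lens-6 development «surd» (instances of 28994/4280) — see the module docstring; verbatim from the lens file. -/
@[simp] private theorem snoc2_zero (x : Fin 1 → ℝ) (t : ℝ) : (Fin.snoc x t : Fin 2 → ℝ) 0 = x 0 := rfl

/-- `snoc2_one`: auxiliary theorem of the lens-6 development «surd» (instances of 28994/4280) — see the module docstring; verbatim from the lens file. -/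
@[simp] private theorem snoc2_one (x : Fin 1 → ℝ) (t : ℝ) : (Fin.snoc x t : Fin 2 → ℝ) 1 = t := rfl

/-- `init2_zero`: auxiliary theorem of the lens-6 development «surd» (instances of 28994/4280) — see the module docstring; verbatim from the lens file. -/
@[simp] private theorem init2_zero (z : Fin 2 → ℝ) : Fin.init z 0 = z 0 := rfl

/-- `fin1_eq`: auxiliary theorem of the lens-6 development «surd» (instances of 28994/4280) — see the module docstring; verbatim from the lens file. -/
private theorem fin1_eq (y : Fin 1 → ℝ) : y = fun _ => y 0 := funext fun i => by rw [Fin.fin_one_eq_zero i]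

/-- **One-variable substitution `t = κ(t')` in the base of the band** (rule 2, via
`KZ.of_sub_of_mem_relations_covLift`): if `κ : [a,b] → [a',b']` is a rational bijection with
`V = V' ∘ κ` and `w = (w' ∘ κ)·|κ'|` on `[a,b]`, then `LB(a,b,w,V) ≡ LB(a',b',w',V')`. -/
theorem rel_subst {a b a' b' : ℚ} (Wt : BaseWt a b) (Wt' : BaseWt a' b') (V : LogArg a b)
    (V' : LogArg a' b') (κ κd : ℝ → ℝ)
    (pn pd : MvPolynomial (Fin 1) ℚ) (hpd : ∀ y ∈ ivl a b, aeval y pd ≠ 0)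
    (hκp : ∀ y ∈ ivl a b, aeval y pn / aeval y pd = κ (y 0))
    (hκd : ∀ t ∈ Icc (a : ℝ) b, HasDerivAt κ (κd t) t)
    (hinj : InjOn κ (Icc (a : ℝ) b)) (himg : κ '' Icc (a : ℝ) b = Icc (a' : ℝ) b')
    (hv : ∀ t ∈ Icc (a : ℝ) b, V.v t = V'.v (κ t))
    (hh : ∀ t ∈ Icc (a : ℝ) b, Wt.w t = Wt'.w (κ t) * |κd t|) :
    KZ.of (LB a b Wt V) - KZ.of (LB a' b' Wt' V') ∈ KZ.relations := by
  have hσ := isSemialgebraic_ivl a b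
  let Φ : (Fin 1 → ℝ) → (Fin 1 → ℝ) := fun y _ => κ (y 0)
  let Φ' : (Fin 1 → ℝ) → (Fin 1 → ℝ) →L[ℝ] (Fin 1 → ℝ) := fun y =>
    κd (y 0) • ContinuousLinearMap.id ℝ (Fin 1 → ℝ)
  have hdet : ∀ y, (Φ' y).det = κd (y 0) := fun y => by
    simp only [Φ', ContinuousLinearMap.det, ContinuousLinearMap.toLinearMap_smul, ContinuousLinearMap.coe_id,
      LinearMap.det_smul, LinearMap.det_id, Module.finrank_fin_fun, pow_one, mul_one]
  have himage : Φ '' ivl a b = ivl a' b' := by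
    ext w
    constructor
    · rintro ⟨y, hy, rfl⟩
      have : κ (y 0) ∈ Icc (a' : ℝ) b' := himg ▸ mem_image_of_mem κ hy
      exact this
    · intro hw
      obtain ⟨t, ht, htw⟩ : w 0 ∈ κ '' Icc (a : ℝ) b := himg ▸ hw
      refine ⟨fun _ => t, ht, ?_⟩
      rw [fin1_eq w]
      exact funext fun _ => htw
  refine KZ.of_sub_of_mem_relations_covLift (σ := ivl a b) (Φ := Φ) (Φ' := Φ')
    (v := fun y => V.v (y 0)) (v' := fun y => V'.v (y 0)) ?_ ?_ ?_ (fun y hy => hv _ hy)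
    (LB a b Wt V) (LB a' b' Wt' V') rfl (by rw [himage]; rfl) fun z hz => ?_
  · exact (isSemialgebraicMapOn_iff_forall_holds hσ).mpr fun _ =>
      (isSemialgebraicFunOn_aeval_div_aeval hσ pn pd hpd).congr fun y hy => hκp y hy
  · intro y hy
    have h1 : HasFDerivAt (fun y : Fin 1 → ℝ => κ (y 0))
        (κd (y 0) • ContinuousLinearMap.proj (R := ℝ) (φ := fun _ : Fin 1 => ℝ) 0) y :=
      (hκd _ hy).comp_hasFDerivAt y (hasFDerivAt_apply 0 y)
    have h2 : HasFDerivAt Φ (ContinuousLinearMap.pi fun _ : Fin 1 =>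
        κd (y 0) • ContinuousLinearMap.proj (R := ℝ) (φ := fun _ : Fin 1 => ℝ) 0) y :=
      hasFDerivAt_pi.2 fun _ => h1
    have h3 : (ContinuousLinearMap.pi fun _ : Fin 1 =>
        κd (y 0) • ContinuousLinearMap.proj (R := ℝ) (φ := fun _ : Fin 1 => ℝ) 0) = Φ' y := by
      ext w i
      rw [Fin.fin_one_eq_zero i]
      simp [Φ']
    exact (h3 ▸ h2).hasFDerivWithinAt
  · intro y₁ hy₁ y₂ hy₂ h
    have h0 : κ (y₁ 0) = κ (y₂ 0) := congrFun h 0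
    rw [fin1_eq y₁, fin1_eq y₂, hinj hy₁ hy₂ h0]
  · have hz0 : z 0 ∈ Icc (a : ℝ) b := (mem_bandOf.1 hz).1
    rw [hdet]
    change Wt.w (z 0) / z 1 = Wt'.w (κ (z 0)) / z 1 * |κd (z 0)|
    rw [hh _ hz0]; ring

/-- `rel_cut` with the two pieces given by arbitrary (pointwise equal) arguments and weights. -/
theorem rel_cut' (a m b : ℚ) (Wt : BaseWt a b) (V : LogArg a b) (W₁ : BaseWt a m) (V₁ : LogArg a m)
    (W₂ : BaseWt m b) (V₂ : LogArg m b) (ham : a ≤ m) (hmb : m ≤ b)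
    (hw₁ : ∀ t ∈ Icc (a : ℝ) m, W₁.w t = Wt.w t) (h₁ : ∀ t ∈ Icc (a : ℝ) m, V₁.v t = V.v t)
    (hw₂ : ∀ t ∈ Icc (m : ℝ) b, W₂.w t = Wt.w t) (h₂ : ∀ t ∈ Icc (m : ℝ) b, V₂.v t = V.v t) :
    KZ.of (LB a b Wt V) - KZ.of (LB a m W₁ V₁) - KZ.of (LB m b W₂ V₂) ∈ KZ.relations := by
  have h0 := rel_cut a m b Wt V ham hmb
  have e1 := rel_congr a m (Wt.restr a m ⟨le_rfl, by exact_mod_cast hmb⟩) W₁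
    (V.restr a m ⟨le_rfl, by exact_mod_cast hmb⟩) V₁ (fun t ht => (hw₁ t ht).symm) fun t ht => (h₁ t ht).symm
  have e2 := rel_congr m b (Wt.restr m b ⟨by exact_mod_cast ham, le_rfl⟩) W₂
    (V.restr m b ⟨by exact_mod_cast ham, le_rfl⟩) V₂ (fun t ht => (hw₂ t ht).symm) fun t ht => (h₂ t ht).symm
  have h := add_mem (add_mem h0 e1) e2
  convert h using 1
  abel

/-- Transitivity of congruence modulo `KZ.relations`. -/
private theorem rel_trans {x y z : KZ.FormalRep} (h₁ : x - y ∈ KZ.relations) (h₂ : y - z ∈ KZ.relations) :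
    x - z ∈ KZ.relations := by
  have := KZ.relations.add_mem h₁ h₂; rwa [sub_add_sub_cancel] at this

/-! ## §1d Calculus helpers for the rational substitutions (verbatim from generation 7) -/

/-- Injectivity and image of an interval under a map with positive derivative. -/
theorem injOn_image_of_deriv_pos {κ κd : ℝ → ℝ} {a b : ℝ} (hab : a ≤ b)
    (hκd : ∀ t ∈ Icc a b, HasDerivAt κ (κd t) t) (hpos : ∀ t ∈ Icc a b, 0 < κd t) :
    InjOn κ (Icc a b) ∧ κ '' Icc a b = Icc (κ a) (κ b) := by
  have hc : ContinuousOn κ (Icc a b) := fun t ht => (hκd t ht).continuousAt.continuousWithinAt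
  have hm : StrictMonoOn κ (Icc a b) := strictMonoOn_of_deriv_pos (convex_Icc a b) hc fun t ht => by
    rw [interior_Icc] at ht
    rw [(hκd t (Ioo_subset_Icc_self ht)).deriv]
    exact hpos t (Ioo_subset_Icc_self ht)
  refine ⟨hm.injOn, Subset.antisymm ?_ (intermediate_value_Icc hab hc)⟩
  rintro _ ⟨t, ht, rfl⟩
  exact ⟨hm.monotoneOn (left_mem_Icc.2 hab) ht ht.1, hm.monotoneOn ht (right_mem_Icc.2 hab) ht.2⟩

/-- Injectivity and image of an interval under a map with negative derivative. -/
theorem injOn_image_of_deriv_neg {κ κd : ℝ → ℝ} {a b : ℝ} (hab : a ≤ b)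
    (hκd : ∀ t ∈ Icc a b, HasDerivAt κ (κd t) t) (hneg : ∀ t ∈ Icc a b, κd t < 0) :
    InjOn κ (Icc a b) ∧ κ '' Icc a b = Icc (κ b) (κ a) := by
  have hc : ContinuousOn κ (Icc a b) := fun t ht => (hκd t ht).continuousAt.continuousWithinAt
  have hm : StrictAntiOn κ (Icc a b) := strictAntiOn_of_deriv_neg (convex_Icc a b) hc fun t ht => by
    rw [interior_Icc] at ht
    rw [(hκd t (Ioo_subset_Icc_self ht)).deriv]
    exact hneg t (Ioo_subset_Icc_self ht)
  refine ⟨hm.injOn, Subset.antisymm ?_ (intermediate_value_Icc' hab hc)⟩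
  rintro _ ⟨t, ht, rfl⟩
  exact ⟨hm.antitoneOn ht (right_mem_Icc.2 hab) ht.2, hm.antitoneOn (left_mem_Icc.2 hab) ht ht.1⟩

/-! ## §2 The linear-fibre unfolding `[□², c/(α(x)y + β(x))] ≡ LB(c/α, (α+β)/β)` -/

/-- **Linear-fibre unfolding** (rule 2, one fibrewise affine substitution `s = (α(x)y + β(x))/β(x)`,
Literature `KZ.of_sub_of_mem_relations_of_fibreMap`): for `α, β` polynomial and positive on `[0,1]`,
`[□², c/(α(x)·y + β(x))] ≡ [0 ≤ t ≤ 1, 1 ≤ s ≤ (α(t)+β(t))/β(t); (c/α(t)) ds dt/s]`. -/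
theorem linFibre (T : RFun 2) (c : ℝ) (α β : ℝ → ℝ) (pα pβ : MvPolynomial (Fin 2) ℚ)
    (hpα : ∀ z : Fin 2 → ℝ, aeval z pα = α (z 0)) (hpβ : ∀ z : Fin 2 → ℝ, aeval z pβ = β (z 0))
    (hαd : Differentiable ℝ α) (hβd : Differentiable ℝ β)
    (hα : ∀ t ∈ Icc (0 : ℝ) 1, 0 < α t) (hβ : ∀ t ∈ Icc (0 : ℝ) 1, 0 < β t)
    (hT : ∀ z ∈ cube 2, T.fn z = c / (α (z 0) * z 1 + β (z 0)))
    (W : BaseWt 0 1) (hW : ∀ t ∈ Icc (0 : ℝ) 1, W.w t = c / α t)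
    (V : LogArg 0 1) (hV : ∀ t ∈ Icc (0 : ℝ) 1, V.v t = (α t + β t) / β t) :
    KZ.of T.rep - KZ.of (LB 0 1 W V) ∈ KZ.relations := by
  have hz0 : ∀ z ∈ cube 2, z 0 ∈ Icc (0 : ℝ) 1 := fun z hz => ⟨(hz 0).1, (hz 0).2⟩
  refine of_sub_of_mem_relations_of_fibreMap (G := ivl 0 1) (a := fun _ => 0) (b := fun _ => 1)
    (a' := fun _ => 1) (b' := fun y => V.v (y 0))
    (fun z => (α (z 0) * z 1 + β (z 0)) / β (z 0)) (fun z => α (z 0) / β (z 0))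
    T.rep (LB 0 1 W V) cube_eq_band rfl (fun _ _ => zero_le_one) ?_ ?_ ?_ ?_ ?_ ?_ ?_
  · -- `ψ` is `ℚ`-semialgebraic on the square
    refine (isSemialgebraicFunOn_aeval_div_aeval isSemialgebraic_cube (pα * X 1 + pβ) pβ
      fun z hz => ?_).congr fun z _ => ?_
    · rw [hpβ]; exact (hβ _ (hz0 z hz)).ne'
    · simp only [map_add, map_mul, aeval_X, hpα, hpβ]
  · -- differentiable
    intro z hz
    have hne := (hβ _ (hz0 z hz)).ne'
    fun_prop (disch := exact hne)
  · -- derivative along the fibre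
    intro z hz
    show HasDerivAt (fun t => (α ((Fin.snoc (Fin.init z) t : Fin 2 → ℝ) 0) *
      (Fin.snoc (Fin.init z) t : Fin 2 → ℝ) 1 + β ((Fin.snoc (Fin.init z) t : Fin 2 → ℝ) 0)) /
      β ((Fin.snoc (Fin.init z) t : Fin 2 → ℝ) 0)) _ (z 1)
    simp only [snoc2_zero, snoc2_one, init2_zero]
    exact ((((hasDerivAt_id' (z 1)).const_mul (α (z 0))).add_const (β (z 0))).div_const
      (β (z 0))).congr_deriv (by ring)
  · -- positive fibre derivative
    intro z hz
    exact div_pos (hα _ (hz0 z hz)) (hβ _ (hz0 z hz))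
  · -- lower edge `y = 0 ↦ s = 1`
    intro y hy
    have hy' : y 0 ∈ Icc (0 : ℝ) 1 := by simpa [mem_ivl] using hy
    have hne := (hβ _ hy').ne'
    show (α ((Fin.snoc y (0 : ℝ) : Fin 2 → ℝ) 0) * (Fin.snoc y (0 : ℝ) : Fin 2 → ℝ) 1 +
      β ((Fin.snoc y (0 : ℝ) : Fin 2 → ℝ) 0)) / β ((Fin.snoc y (0 : ℝ) : Fin 2 → ℝ) 0) = 1
    simp only [snoc2_zero, snoc2_one, mul_zero, zero_add]
    exact div_self hne
  · -- upper edge `y = 1 ↦ s = (α+β)/β`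
    intro y hy
    have hy' : y 0 ∈ Icc (0 : ℝ) 1 := by simpa [mem_ivl] using hy
    show (α ((Fin.snoc y (1 : ℝ) : Fin 2 → ℝ) 0) * (Fin.snoc y (1 : ℝ) : Fin 2 → ℝ) 1 +
      β ((Fin.snoc y (1 : ℝ) : Fin 2 → ℝ) 0)) / β ((Fin.snoc y (1 : ℝ) : Fin 2 → ℝ) 0) = V.v (y 0)
    simp only [snoc2_zero, snoc2_one, mul_one]
    exact (hV _ hy').symm
  · -- integrands
    intro z hz
    have hzc : z ∈ cube 2 := hz
    have hα' := hα _ (hz0 z hzc)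
    have hβ' := hβ _ (hz0 z hzc)
    have hz1 : (0 : ℝ) ≤ z 1 := (hzc 1).1
    have hD : 0 < α (z 0) * z 1 + β (z 0) := by
      have h1 := mul_nonneg hα'.le hz1
      linarith
    rw [RFun.rep_integrand, hT z hzc, LB_integrand]
    simp only [snoc2_zero, snoc2_one, init2_zero]
    rw [hW _ (hz0 z hzc)]
    field_simp

/-! ## §3 The involution `κ(t) = (1−t)/(1+t)` of `[0,1]`, the two weights and the four arguments -/

/-- `I01`: auxiliary theorem of the lens-6 development «surd» (instances of 28994/4280) — see the module docstring; verbatim from the lens file. -/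
theorem I01 {t : ℝ} (ht : t ∈ Icc ((0 : ℚ) : ℝ) ((1 : ℚ) : ℝ)) : 0 ≤ t ∧ t ≤ 1 := by simpa using ht

/-- The involution `κ(t) = (1 − t)/(1 + t)` of `[0,1]` (fixed point `√2 − 1`). -/
def κ (t : ℝ) : ℝ := (1 - t) / (1 + t)
/-- `κ'(t) = −2/(1+t)²`. -/
def κd (t : ℝ) : ℝ := -2 / (1 + t) ^ 2

/-- `hasDerivAt_κ`: auxiliary theorem of the lens-6 development «surd» (instances of 28994/4280) — see the module docstring; verbatim from the lens file. -/
theorem hasDerivAt_κ {t : ℝ} (h : 1 + t ≠ 0) : HasDerivAt κ (κd t) t := by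
  have h1 : HasDerivAt (fun t : ℝ => 1 - t) (-1) t := by simpa using (hasDerivAt_id' t).const_sub 1
  have h2 : HasDerivAt (fun t : ℝ => 1 + t) 1 t := by simpa using (hasDerivAt_id' t).const_add 1
  exact (h1.div h2 h).congr_deriv (by unfold κd; field_simp; ring)

/-- `one_add_κ`: auxiliary theorem of the lens-6 development «surd» (instances of 28994/4280) — see the module docstring; verbatim from the lens file. -/
theorem one_add_κ {t : ℝ} (h : 1 + t ≠ 0) : 1 + κ t = 2 / (1 + t) := by
  unfold κ; field_simp; ring
/-- `two_add_two_κ`: auxiliary theorem of the lens-6 development «surd» (instances of 28994/4280) — see the module docstring; verbatim from the lens file. -/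
theorem two_add_two_κ {t : ℝ} (h : 1 + t ≠ 0) : 2 + 2 * κ t = 4 / (1 + t) := by
  unfold κ; field_simp; ring
/-- `κ` carries the conic `2 − t + t²` to `1 + t + 2t²`: `1 + κ + 2κ² = 2(2 − t + t²)/(1+t)²`. -/
theorem βA_κ {t : ℝ} (h : 1 + t ≠ 0) : 1 + κ t + 2 * κ t ^ 2 = 2 * (2 - t + t ^ 2) / (1 + t) ^ 2 := by
  unfold κ; field_simp; ring
/-- `nA1_κ`: auxiliary theorem of the lens-6 development «surd» (instances of 28994/4280) — see the module docstring; verbatim from the lens file. -/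
theorem nA1_κ {t : ℝ} (h : 1 + t ≠ 0) : 2 + 2 * κ t + 2 * κ t ^ 2 = 2 * (3 + t ^ 2) / (1 + t) ^ 2 := by
  unfold κ; field_simp; ring
/-- `nA2_κ`: auxiliary theorem of the lens-6 development «surd» (instances of 28994/4280) — see the module docstring; verbatim from the lens file. -/
theorem nA2_κ {t : ℝ} (h : 1 + t ≠ 0) :
    3 + 3 * κ t + 2 * κ t ^ 2 = 2 * (4 + t + t ^ 2) / (1 + t) ^ 2 := by
  unfold κ; field_simp; ring

/-- `βA_pos`: auxiliary theorem of the lens-6 development «surd» (instances of 28994/4280) — see the module docstring; verbatim from the lens file. -/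
theorem βA_pos (t : ℝ) : 0 < 1 + t + 2 * t ^ 2 := by nlinarith [sq_nonneg (t + 1 / 4)]
/-- `βB_pos`: auxiliary theorem of the lens-6 development «surd» (instances of 28994/4280) — see the module docstring; verbatim from the lens file. -/
theorem βB_pos (t : ℝ) : 0 < 2 - t + t ^ 2 := by nlinarith [sq_nonneg (t - 1 / 2)]

/-- `w₁(t) = 1/(1+t)` (pair #1: `α = 1 + x`). -/
def w1F (t : ℝ) : ℝ := 1 / (1 + t)
/-- `w₂(t) = 1/(2+2t)` (pair #2: `α = 2 + 2x`). -/
def w2F (t : ℝ) : ℝ := 1 / (2 + 2 * t)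
/-- `V_{A1} = (α+β_A)/β_A = (2+2t+2t²)/(1+t+2t²)`. -/
def vA1F (t : ℝ) : ℝ := (2 + 2 * t + 2 * t ^ 2) / (1 + t + 2 * t ^ 2)
/-- `V_{B1} = (α+β_B)/β_B = (3+t²)/(2−t+t²)`. -/
def vB1F (t : ℝ) : ℝ := (3 + t ^ 2) / (2 - t + t ^ 2)
/-- `V_{A2} = (3+3t+2t²)/(1+t+2t²)`. -/
def vA2F (t : ℝ) : ℝ := (3 + 3 * t + 2 * t ^ 2) / (1 + t + 2 * t ^ 2)
/-- `V_{B2} = (4+t+t²)/(2−t+t²)`. -/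
def vB2F (t : ℝ) : ℝ := (4 + t + t ^ 2) / (2 - t + t ^ 2)

/-- `aeval_βA_ne`: auxiliary theorem of the lens-6 development «surd» (instances of 28994/4280) — see the module docstring; verbatim from the lens file. -/
theorem aeval_βA_ne (y : Fin 1 → ℝ) : aeval y (1 + X 0 + 2 * X 0 ^ 2 : MvPolynomial (Fin 1) ℚ) ≠ 0 := by
  have := βA_pos (y 0)
  simp only [map_add, map_mul, map_pow, map_ofNat, map_one, aeval_X] at this ⊢
  exact this.ne'
/-- `aeval_βB_ne`: auxiliary theorem of the lens-6 development «surd» (instances of 28994/4280) — see the module docstring; verbatim from the lens file. -/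
theorem aeval_βB_ne (y : Fin 1 → ℝ) : aeval y (2 - X 0 + X 0 ^ 2 : MvPolynomial (Fin 1) ℚ) ≠ 0 := by
  have := βB_pos (y 0)
  simp only [map_add, map_sub, map_pow, map_ofNat, aeval_X] at this ⊢
  exact this.ne'

/-- The weight `1/(1+t)` on `[0,1]`. -/
def W1 : BaseWt 0 1 :=
  mkWt 0 1 w1F 1 (1 + X 0)
    (fun y hy => by
      have h0 := (I01 hy).1
      simp only [map_add, map_one, aeval_X]
      exact (show (0 : ℝ) < 1 + y 0 by linarith).ne')
    (fun y _ => by simp [w1F])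
    ((by fun_prop : Continuous fun _ : ℝ => (1 : ℝ)).continuousOn.div
      (by fun_prop : Continuous fun t : ℝ => 1 + t).continuousOn
      fun t ht => (show (0 : ℝ) < 1 + t by linarith [(I01 ht).1]).ne')
/-- The weight `1/(2+2t)` on `[0,1]`. -/
def W2 : BaseWt 0 1 :=
  mkWt 0 1 w2F 1 (2 + 2 * X 0)
    (fun y hy => by
      have h0 := (I01 hy).1
      simp only [map_add, map_mul, map_ofNat, aeval_X]
      exact (show (0 : ℝ) < 2 + 2 * y 0 by linarith).ne')
    (fun y _ => by simp [w2F])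
    ((by fun_prop : Continuous fun _ : ℝ => (1 : ℝ)).continuousOn.div
      (by fun_prop : Continuous fun t : ℝ => 2 + 2 * t).continuousOn
      fun t ht => (show (0 : ℝ) < 2 + 2 * t by linarith [(I01 ht).1]).ne')

/-- `VA1`: auxiliary def of the lens-6 development «surd» (instances of 28994/4280) — see the module docstring; verbatim from the lens file. -/
def VA1 : LogArg 0 1 :=
  mkArg 0 1 vA1F (2 + 2 * X 0 + 2 * X 0 ^ 2) (1 + X 0 + 2 * X 0 ^ 2) (fun y _ => aeval_βA_ne y)
    (fun y _ => by simp [vA1F]) (fun t ht => by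
      have h0 := (I01 ht).1
      unfold vA1F; rw [le_div_iff₀ (βA_pos t)]; nlinarith)
    ((by fun_prop : Continuous fun t : ℝ => 2 + 2 * t + 2 * t ^ 2).continuousOn.div
      (by fun_prop : Continuous fun t : ℝ => 1 + t + 2 * t ^ 2).continuousOn fun t _ => (βA_pos t).ne')
/-- `VB1`: auxiliary def of the lens-6 development «surd» (instances of 28994/4280) — see the module docstring; verbatim from the lens file. -/
def VB1 : LogArg 0 1 :=
  mkArg 0 1 vB1F (3 + X 0 ^ 2) (2 - X 0 + X 0 ^ 2) (fun y _ => aeval_βB_ne y)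
    (fun y _ => by simp [vB1F]) (fun t ht => by
      have h0 := (I01 ht).1
      unfold vB1F; rw [le_div_iff₀ (βB_pos t)]; nlinarith)
    ((by fun_prop : Continuous fun t : ℝ => 3 + t ^ 2).continuousOn.div
      (by fun_prop : Continuous fun t : ℝ => 2 - t + t ^ 2).continuousOn fun t _ => (βB_pos t).ne')
/-- `VA2`: auxiliary def of the lens-6 development «surd» (instances of 28994/4280) — see the module docstring; verbatim from the lens file. -/
def VA2 : LogArg 0 1 :=
  mkArg 0 1 vA2F (3 + 3 * X 0 + 2 * X 0 ^ 2) (1 + X 0 + 2 * X 0 ^ 2) (fun y _ => aeval_βA_ne y)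
    (fun y _ => by simp [vA2F]) (fun t ht => by
      have h0 := (I01 ht).1
      unfold vA2F; rw [le_div_iff₀ (βA_pos t)]; nlinarith)
    ((by fun_prop : Continuous fun t : ℝ => 3 + 3 * t + 2 * t ^ 2).continuousOn.div
      (by fun_prop : Continuous fun t : ℝ => 1 + t + 2 * t ^ 2).continuousOn fun t _ => (βA_pos t).ne')
/-- `VB2`: auxiliary def of the lens-6 development «surd» (instances of 28994/4280) — see the module docstring; verbatim from the lens file. -/
def VB2 : LogArg 0 1 :=
  mkArg 0 1 vB2F (4 + X 0 + X 0 ^ 2) (2 - X 0 + X 0 ^ 2) (fun y _ => aeval_βB_ne y)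
    (fun y _ => by simp [vB2F]) (fun t ht => by
      have h0 := (I01 ht).1
      unfold vB2F; rw [le_div_iff₀ (βB_pos t)]; nlinarith)
    ((by fun_prop : Continuous fun t : ℝ => 4 + t + t ^ 2).continuousOn.div
      (by fun_prop : Continuous fun t : ℝ => 2 - t + t ^ 2).continuousOn fun t _ => (βB_pos t).ne')

end Summit.KontsevichZagierPeriods.RootDecompQuadraticDescent.SurdPairs

end
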